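import Literature.AnabelianGeometry.SemiGraphs.TemperedVertexActionIntertwining
import Literature.AnabelianGeometry.SemiGraphs.TemperedSpecialFibreDataVertexAction
import Literature.AnabelianGeometry.SemiGraphs.TemperedSpecialFibreReductions
import HarnessLib

/-!
# Vertex actions intertwined along chart-compatible morphisms, II: the BASE special fibres of two curves, and
# a tower level over its base fibre ([SemiAnbd] Ex. 3.10, Cor. 3.11 «compatible»; [IUTchI] §2; proof-only)

Mochizuki, *Semi-graphs of anabelioids*, Publ. RIMS **42** (2006), §3, Ex. 3.10 pp. 44–45 («semi-graphs of
anabelioids `𝒢_i`, `𝒢^c_i` on which `Δ_i` acts … natural morphisms … compatible with the actions»; «the natural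
quotient `Δ ↠ π₁^temp(𝒢) ≅ π₁^temp(𝒢^c)`») and Cor. 3.11 p. 46 («compatible») [cite: MochizukiSemiAnbd2006, Ex 3.10 pp.44-45];
[IUTchI] §2 p. 47 («the natural action of `G_k` on `𝔾`») and proof of Prop. 2.4 (i) p. 50 (the action of `Π^tp_X`
on the special fibre of `X_J` through `Π^tp_X/J`) [cite: Mochizuki2012, Prop 2.4(i) p.50]
[claim: Mochizuki2012, status: disputed] (nothing of the IUT series is asserted here).

abc-iut cell, layer L3, seat abc-iut-L3-d2 gen 7 — the banked sequel (I1)+(I3) of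
`TemperedVertexActionIntertwining.lean` (L3-lead δ2 (6) GO).  PROOF-ONLY (no `def`, no `instance`, no notation,
no `Prop` fact): two further one-line instantiations of the generic engine
`ProfiniteSemiGraph.verticialSubgroups_map_of_intertwines` (Thm. 3.7 (ii)/(iv) at the target + Prop. 3.2; NO
Cor. 3.9 / 3.11, no origin hypothesis) through abc-iut-L3-t2's dictionaries `SpecialFibreData.actVertex_apply_eq_iff`
/ `SpecialFibreTower.actVertex_apply_eq_iff` and `autOfConj_admissible` / `autOfConj_adm`.

* (I1) `SpecialFibreData.vertexMap_actVertex_of_intertwines` / `_of_descends` / `_of_chartCompatible` — the BASE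
  special fibres `𝒢^c[α]`, `𝒢^c[β]` of two curves over ANY fields: for a morphism `F : 𝒢^c[α] → 𝒢^c[β]` locally
  open on vertex groups and `φ : π₁^temp(𝒢^c[α]) → π₁^temp(𝒢^c[β])` compatible with it on verticial homomorphisms,
  `F (g · v) = γ̃(g) · F v` for the DERIVED actions whenever `φ` descends a homomorphism `γ̃ : Π_α → Π_β` restricting
  to `γ : Δ[α] → Δ[β]` along the admissible quotients (`autOfConj_intertwines_of_descends`; the §6 / [AbsAnab]
  setting of `Π_α ⥲ Π_β` preserving `Δ`).  For `g ∈ Δ` the statement is empty (`Δ` acts trivially on the base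
  fibre, `actVertex_coe_eq_one`): the content is the `G_K`-part.  The SELF-map case `φ = autOfConj g` is
  abc-iut-L3-d1's `cor311Compatible_conjDelta_vertexMap` (`SpecialFibreConjugationGraphic.lean`), not redone.
* (I3) `SpecialFibreTower.vertexMap_actVertex_toBase_of_intertwines` / `_of_descends` — a level `𝒢^c_i` of a
  special-fibre tower over a base special fibre `𝒢^c` along a chart-compatible, locally open projection whose
  `φ` descends a homomorphism `ι : N_i → Δ` carrying conjugation by `g` to conjugation by `g₀` (e.g. the
  inclusion, `g₀ = g`): `F (g · v) = g₀ · F v` for EVERY `g` — the law `PiData.proj_actVertex` (today read off the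
  semi-graph DATA `proj_actGraph`) as a THEOREM for chart-level projections.

HONEST LIMITS.  Vertices only (open edges are invisible to `π₁^temp`, Rmk. 3.9.1); `PiData.proj i` is bare
semi-graph data, so (I3) is the law such a projection satisfies, not a rewrite of that record.  Nothing here
asserts anything for a curve, asserts or refutes abc, or takes a side on [IUTchIII] Cor. 3.12; typed ≠ proved.
-/

noncomputable section

namespace Literature.AnabelianGeometry.SemiGraphs

open ProfiniteSemiGraph Topology
open scoped Pointwise

universe u

/-! ### (I1) The base special fibres of two curves: `F (gα · v) = gβ · F v` -/

namespace SpecialFibreData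

variable {Kα : Type u} [Field Kα] {Kβ : Type u} [Field Kβ]
  {Dα : TemperedArithmeticGroup Kα} {Dβ : TemperedArithmeticGroup Kβ}
  (Sα : SpecialFibreData Dα) (Sβ : SpecialFibreData Dβ)
  (hK0α : (Sα.admissible.toMonoidHom.ker.map Dα.delta.subtype).Normal)
  (hK0β : (Sβ.admissible.toMonoidHom.ker.map Dβ.delta.subtype).Normal)

/-- **The intertwining of the conjugation automorphisms DERIVED when `φ` descends a homomorphism of the
arithmetic groups**: if `γ̃ : Π_α → Π_β` restricts to `γ : Δ[α] → Δ[β]` and `φ ∘ q_α = q_β ∘ γ` on the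
admissible quotients `q_□ : Δ[□] ↠ π₁^temp(𝒢^c[□])`, then `φ ∘ autOfConj g = autOfConj (γ̃ g) ∘ φ` for every
`g ∈ Π_α` (`autOfConj_admissible`: both sides are `q_β (γ (g n g⁻¹))` on `q_α n`).
[cite: MochizukiSemiAnbd2006, Ex 3.10 p.44] -/
theorem autOfConj_intertwines_of_descends (φ : Sα.chart.G →* Sβ.chart.G) (γt : Dα.Pi →* Dβ.Pi)
    (γ : Dα.delta →* Dβ.delta) (hγ : ∀ n : Dα.delta, γt n = γ n)
    (hφ : ∀ n : Dα.delta, φ (Sα.admissible n) = Sβ.admissible (γ n)) (g : Dα.Pi) (x : Sα.chart.G) :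
    φ (Sα.autOfConj hK0α g x) = Sβ.autOfConj hK0β (γt g) (φ x) := by
  obtain ⟨n, rfl⟩ := Sα.admissible_surjective x
  rw [autOfConj_admissible, hφ, hφ, autOfConj_admissible]
  congr 1
  apply Subtype.ext
  simp only [coe_conjDelta, ← hγ, ← map_mul, ← map_inv]

variable (hivα : MaximalCompactIffVerticialAt Sα.Gc) (hivβ : MaximalCompactIffVerticialAt Sβ.Gc)
  (F : Hom Sα.Gc Sβ.Gc)
  (hFo : ∀ v, IsOpen ((F.hV v).toMonoidHom.range : Set (Sβ.Gc.Gv (F.base.vertexMap v))))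
  (φ : Sα.chart.G →* Sβ.chart.G)
  (hφ : ∀ (v : Sα.Gc.graph.Vertex) (ψ : Sα.Gc.Gv v →ₜ* Sα.chart.G)
    (ψ' : Sβ.Gc.Gv (F.base.vertexMap v) →ₜ* Sβ.chart.G),
    IsVerticialHom Sα.chart v ψ → IsVerticialHom Sβ.chart (F.base.vertexMap v) ψ' →
      ∃ g : Sβ.chart.G, ∀ x, φ (ψ x) = g * ψ' (F.hV v x) * g⁻¹)

include hFo hφ

/-- ★ (I1) **The derived vertex actions are intertwined along a chart-compatible, locally open morphism of
the special fibres**: if `φ : π₁^temp(𝒢^c[α]) → π₁^temp(𝒢^c[β])` is compatible with `F : 𝒢^c[α] → 𝒢^c[β]` on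
verticial homomorphisms and `φ ∘ autOfConj gα = autOfConj gβ ∘ φ`, then `F (gα · v) = gβ · F v` for
abc-iut-L3-t2's `actVertex` (Ex. 3.10; [IUTchI] p. 47 "the natural action of `G_k` on `𝔾`").
[cite: MochizukiSemiAnbd2006, Ex 3.10 p.44] -/
theorem vertexMap_actVertex_of_intertwines {gα : Dα.Pi} {gβ : Dβ.Pi}
    (hg : ∀ x, φ (Sα.autOfConj hK0α gα x) = Sβ.autOfConj hK0β gβ (φ x)) (v : Sα.Gc.graph.Vertex) :
    F.base.vertexMap (Sα.actVertex hK0α hivα gα v) = Sβ.actVertex hK0β hivβ gβ (F.base.vertexMap v) := by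
  symm
  rw [actVertex_apply_eq_iff]
  obtain ⟨H, hH⟩ := Sα.verticialSubgroups_nonempty v
  exact verticialSubgroups_map_of_intertwines Sβ.hyp Sα.chart Sβ.chart F hFo φ hφ hivβ
    (Sα.autOfConj hK0α gα).toMonoidHom (Sβ.autOfConj hK0β gβ) hg
    ⟨H, hH, (Sα.actVertex_apply_eq_iff hK0α hivα gα v _).1 rfl H hH⟩

/-- ★ (I1) **along a descended homomorphism**: with `F`, `φ`, `γ̃ ⊇ γ` as above, `F (g · v) = γ̃(g) · F v` for
every `g ∈ Π_α` — the `Π`-equivariance of the underlying vertex map of a compatible morphism of special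
fibres, for the DERIVED actions (no Cor. 3.9 / 3.11 input; the §6 / [AbsAnab] setting of an isomorphism
`Π_α ⥲ Π_β` preserving `Δ`). [cite: MochizukiSemiAnbd2006, Cor 3.11 p.46] -/
theorem vertexMap_actVertex_of_descends (γt : Dα.Pi →* Dβ.Pi) (γ : Dα.delta →* Dβ.delta)
    (hγ : ∀ n : Dα.delta, γt n = γ n) (hφγ : ∀ n : Dα.delta, φ (Sα.admissible n) = Sβ.admissible (γ n))
    (g : Dα.Pi) (v : Sα.Gc.graph.Vertex) :
    F.base.vertexMap (Sα.actVertex hK0α hivα g v) =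
      Sβ.actVertex hK0β hivβ (γt g) (F.base.vertexMap v) :=
  Sα.vertexMap_actVertex_of_intertwines Sβ hK0α hK0β hivα hivβ F hFo φ hφ
    (Sα.autOfConj_intertwines_of_descends Sβ hK0α hK0β φ γt γ hγ hφγ g) v

omit hFo hφ in
/-- (I1) for an ISOMORPHISM (locally trivial `F'`) that is `ChartCompatible` with an isomorphism `φ'` of the
tempered fundamental groups of the special fibres (the inner clause of `Cor311Compatible`).
[cite: MochizukiSemiAnbd2006, Cor 3.11 p.46] -/
theorem vertexMap_actVertex_of_chartCompatible {F' : Hom Sα.Gc Sβ.Gc} (hF : F'.IsLocallyTrivial)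
    {φ' : Sα.chart.G ≃ₜ* Sβ.chart.G} (hc : Sα.ChartCompatible Sβ φ' F') {gα : Dα.Pi} {gβ : Dβ.Pi}
    (hg : ∀ x, φ' (Sα.autOfConj hK0α gα x) = Sβ.autOfConj hK0β gβ (φ' x)) (v : Sα.Gc.graph.Vertex) :
    F'.base.vertexMap (Sα.actVertex hK0α hivα gα v) = Sβ.actVertex hK0β hivβ gβ (F'.base.vertexMap v) :=
  Sα.vertexMap_actVertex_of_intertwines Sβ hK0α hK0β hivα hivβ F' (isOpen_range_hV_of_isLocallyTrivial hF)
    φ'.toMonoidHom (fun v ψ ψ' hψ hψ' => hc v ψ ψ' hψ hψ') hg v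

end SpecialFibreData

/-! ### (I3) A tower level over a base special fibre: `F (g · v) = g₀ · F v` for every `g` -/

namespace SpecialFibreTower

variable {Γ : Type u} [Group Γ] [TopologicalSpace Γ] [IsTopologicalGroup Γ] {Δ : Subgroup Γ} [Δ.Normal]
  (T : SpecialFibreTower Δ) (hP0 : ∀ i, ((T.admKer i).map Δ.subtype).Normal) {i : ℕ}
  {K : Type u} [Field K] {D : TemperedArithmeticGroup K} (S : SpecialFibreData D)
  (hK0 : (S.admissible.toMonoidHom.ker.map D.delta.subtype).Normal)

/-- **The intertwining DERIVED when `φ` descends a homomorphism `ι : N_i → Δ` along the admissible quotients**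
(`φ ∘ adm_i = q ∘ ι`) that carries conjugation by `g` to conjugation by `g₀` — e.g. the inclusion `N_i ≤ Δ`
with `g₀ = g` ([IUTchI] p. 50: `Π^tp_X` acts on `𝔾_J` through `Π^tp_X/J`, compatibly with `𝔾_J → 𝔾`).
[cite: MochizukiSemiAnbd2006, Ex 3.10 p.45] -/
theorem autOfConj_intertwines_toBase_of_descends (φ : (T.chart i).G →* S.chart.G) (ι : T.N i →* D.delta)
    (hφ : ∀ n : T.N i, φ (T.adm i n) = S.admissible (ι n)) {g : Γ} {g₀ : D.Pi}
    (hι : ∀ n : T.N i, ((ι (T.conjN i g n) : D.delta) : D.Pi) = g₀ * (ι n : D.Pi) * g₀⁻¹)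
    (x : (T.chart i).G) : φ (T.autOfConj hP0 i g x) = S.autOfConj hK0 g₀ (φ x) := by
  obtain ⟨n, rfl⟩ := T.adm_surjective i x
  rw [autOfConj_adm, hφ, hφ, SpecialFibreData.autOfConj_admissible]
  congr 1
  exact Subtype.ext (by rw [hι, SpecialFibreData.coe_conjDelta])

variable (hiv : MaximalCompactIffVerticialAt (T.Gc i)) (hiv₀ : MaximalCompactIffVerticialAt S.Gc)
  (F : Hom (T.Gc i) S.Gc) (hFo : ∀ v, IsOpen ((F.hV v).toMonoidHom.range : Set (S.Gc.Gv (F.base.vertexMap v))))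
  (φ : (T.chart i).G →* S.chart.G)
  (hφ : ∀ (v : (T.Gc i).graph.Vertex) (ψ : (T.Gc i).Gv v →ₜ* (T.chart i).G)
    (ψ' : S.Gc.Gv (F.base.vertexMap v) →ₜ* S.chart.G),
    IsVerticialHom (T.chart i) v ψ → IsVerticialHom S.chart (F.base.vertexMap v) ψ' →
      ∃ g : S.chart.G, ∀ x, φ (ψ x) = g * ψ' (F.hV v x) * g⁻¹)

include hFo hφ

/-- ★ (I3) **The derived vertex action of a tower level is intertwined with that of a base special fibre along
a chart-compatible, locally open projection** `F : 𝒢^c_i → 𝒢^c`: `φ ∘ autOfConj_i g = autOfConj g₀ ∘ φ` implies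
`F (g · v) = g₀ · F v` (Ex. 3.10 p. 45 l. 1 «compatible with the actions»; the shape of
`PiData.proj_actVertex`, here a THEOREM for chart-level projections). [cite: MochizukiSemiAnbd2006, Ex 3.10 pp.44-45] -/
theorem vertexMap_actVertex_toBase_of_intertwines {g : Γ} {g₀ : D.Pi}
    (hg : ∀ x, φ (T.autOfConj hP0 i g x) = S.autOfConj hK0 g₀ (φ x)) (v : (T.Gc i).graph.Vertex) :
    F.base.vertexMap (T.actVertex hP0 i hiv g v) = S.actVertex hK0 hiv₀ g₀ (F.base.vertexMap v) := by
  symm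
  rw [SpecialFibreData.actVertex_apply_eq_iff]
  obtain ⟨H, hH⟩ := T.verticialSubgroups_nonempty i v
  exact verticialSubgroups_map_of_intertwines S.hyp (T.chart i) S.chart F hFo φ hφ hiv₀
    (T.autOfConj hP0 i g).toMonoidHom (S.autOfConj hK0 g₀) hg
    ⟨H, hH, (T.actVertex_apply_eq_iff hP0 i hiv g v _).1 rfl H hH⟩

/-- ★ (I3) **along a descended projection**: `F (g · v) = g₀ · F v` for every `g ∈ Γ` whose conjugation `ι`
carries to that of `g₀ ∈ Π` — with `ι` the inclusion `N_i ≤ Δ ≤ Π` and `g₀ = g` this is the `Π`-equivariance of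
the projection `𝒢^c_i → 𝒢^c` on vertices for the DERIVED actions. [cite: MochizukiSemiAnbd2006, Ex 3.10 pp.44-45] -/
theorem vertexMap_actVertex_toBase_of_descends (ι : T.N i →* D.delta)
    (hφι : ∀ n : T.N i, φ (T.adm i n) = S.admissible (ι n)) {g : Γ} {g₀ : D.Pi}
    (hι : ∀ n : T.N i, ((ι (T.conjN i g n) : D.delta) : D.Pi) = g₀ * (ι n : D.Pi) * g₀⁻¹)
    (v : (T.Gc i).graph.Vertex) :
    F.base.vertexMap (T.actVertex hP0 i hiv g v) = S.actVertex hK0 hiv₀ g₀ (F.base.vertexMap v) :=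
  T.vertexMap_actVertex_toBase_of_intertwines hP0 S hK0 hiv hiv₀ F hFo φ hφ
    (T.autOfConj_intertwines_toBase_of_descends hP0 S hK0 φ ι hφι hι) v

end SpecialFibreTower

end Literature.AnabelianGeometry.SemiGraphs

end
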